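import Summits.QuantumFields.YangMills.Theorems.ParabolicTrajectoryTunedSequenceExistsSlackDefs
import Summits.QuantumFields.YangMills.Theses.LangevinControlUV

/-!
# Crux `TunedSequenceExists` (stmt-QuantumFields-10524), line `fixed-aspect-window`, stub
# `stub_volumeSlack` (V_slack): the FIXED-COUPLING INFRARED TAIL is free modulo the sibling route's
# infrared leg `LatticeGapInUVUnitsC` (stmt-QuantumFields-16206)

Notation: `u(β, m, L) := (M^m)⁸ ⟨P ; τ_{M^m} P⟩_{β, 2L+1}`, `P = r.curvature.F`, `D := M^m`.

(V_slack) `FixedAspectSplit.VolumeMonotoneSlack` asks `u(β, m, L₁ M^m) ≤ K · u(β, m, L) + ε` for ALL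
`β ≥ β₁` and ALL `m ≥ m₁` JOINTLY (one depth threshold `m₁` serving every weak coupling).  Its quantifier
block contains the fixed-coupling infrared tail — `β` fixed, `m → ∞`, i.e. lattice separation
`D = M^m → ∞` beyond the correlation length at that `β` — which is lattice-mass-gap territory.  This
file kernel-checks that this tail is FREE modulo the two sibling items of route `LangevinControlUV`:

* `FemtoCurvatureTwoPointC` (stmt-QuantumFields-16204) supplies a continuous unit map `a` with
  `a(β) > 0` carrying the femto two-point package;
* `LatticeGapInUVUnitsC` (stmt-QuantumFields-16206) applied to it gives `c₁ > 0`, `β₂`, `S₁ : ℝ → ℕ` and,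
  for the pair `(P, P)`, a constant `C` with `|⟨P ; τ_n P⟩_{β, 2S+1}| ≤ C · exp (-c₁ a(β) n)` for all
  `β ≥ β₂`, `S ≥ S₁(β)`, `n ≤ S`.

At FIXED `β ≥ β₂`: `D⁸ · C · exp (-c₁ a(β) D) → 0` as `m → ∞` (`Real.tendsto_pow_mul_exp_neg_atTop_nhds_zero`),
and both tori `L₁ M^m ≤ L` are `≥ S₁(β)` and `≥ D` once `m` is large (`L₁ ≥ 1`, `M ≥ 2`), so
`|u(β, m, L)| ≤ ε` for every `L ≥ L₁ M^m` beyond a depth threshold `m₁(β, ε)`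
(`abs_rescaled_le_of_gapC`), and the slack inequality follows for EVERY factor `K > 0` by
`FixedAspectSplit.slack_of_abs_le` (`volumeSlack_fixedCoupling_of_gapC`, registered sub-goal stub;
`volumeSlack_fixedCoupling_of_gapC_uniform` has `β₂ = β₂(G, r)` outermost).

Quantifier order of the by-product: `∃ β₂ ∀ β ≥ β₂ ∃ m₁(β)` (per-coupling depth threshold) versus the
stub's `∃ β₁ m₁ ∀ β ∀ m`.  So, modulo the sibling legs, the CONTENT of (V_slack) is the UNIFORMITY in
`β` of the depth threshold — the crossover band of bounded physical separation `a(β) M^m` (note the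
gap bound `D⁸ C exp(-c₁ a(β) D)` with `β`-uniform `C` is useful only for `c₁ a(β) D ≳ 8 log D`, i.e.
physical separation growing logarithmically in the refinement) — which this file does not touch.  Both
sibling items enter as HYPOTHESES only (open cruxes, never asserted).
References: Osterwalder–Seiler 1978 §2 (transfer matrix, clustering); Lüscher 1983 (finite-size effects).
-/

noncomputable section

open Filter Topology MeasureTheory
open Literature.MathematicalPhysics.QuantumFieldTheory Literature.MathematicalPhysics.QuantumLattice

namespace Summit.QuantumFields.YangMills.Theorems.TunedSequenceExists.SlackInfrared

/-! ## §1 Real analysis: the rescaled exponential tail along `D = M^m` -/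

/-- **`D⁸ · (C · exp (-κ D)) → 0` along `D = M^m`** for `M ≥ 2`, `κ > 0` and any constant `C`:
`x⁸ exp(-x) → 0` (`Real.tendsto_pow_mul_exp_neg_atTop_nhds_zero 8`) composed with `x_m := κ M^m → ∞`,
rescaled by `C / κ⁸`. [folklore] -/
theorem tendsto_rescaled_expTail {M : ℕ} (hM : 2 ≤ M) {κ : ℝ} (hκ : 0 < κ) (C : ℝ) :
    Tendsto (fun m : ℕ => ((M : ℝ) ^ m) ^ 8 * (C * Real.exp (-(κ * (M : ℝ) ^ m)))) atTop (𝓝 0) := by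
  have hM1 : (1 : ℝ) < M := by exact_mod_cast (lt_of_lt_of_le one_lt_two hM)
  have hD : Tendsto (fun m : ℕ => κ * (M : ℝ) ^ m) atTop atTop :=
    (tendsto_pow_atTop_atTop_of_one_lt hM1).const_mul_atTop hκ
  have h := ((Real.tendsto_pow_mul_exp_neg_atTop_nhds_zero 8).comp hD).const_mul (C / κ ^ 8)
  rw [mul_zero] at h
  refine h.congr fun m => ?_
  simp only [Function.comp_apply, mul_pow]
  field_simp

/-! ## §2 Fixed data `(G, r, M)`: fixed-coupling clustering ⇒ the rescaled correlator is eventually small -/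

section FixedData

variable {G : Type} [Group G] [TopologicalSpace G] [IsTopologicalGroup G] [CompactSpace G]
  [MeasurableSpace G] [BorelSpace G]

/-- **Fixed-coupling clustering ⇒ `|u(β, m, L)| ≤ ε` beyond a depth threshold, for all `L ≥ L₁ M^m`.**
If at the coupling `β` the pair `(P, P)` clusters at some rate `κ > 0` on every torus of half-side
`S ≥ S₁` (`|⟨P ; τ_n P⟩_{β, 2S+1}| ≤ C exp(-κ n)`, `n ≤ S`), then for `M ≥ 2`, `L₁ ≥ 1` and every
`ε > 0` there is `m₁` with `|(M^m)⁸ ⟨P ; τ_{M^m} P⟩_{β, 2L+1}| ≤ ε` for all `m ≥ m₁`, `L ≥ L₁ M^m`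
(both side conditions `S₁ ≤ L`, `M^m ≤ L` hold eventually since `M^m → ∞`). [folklore] -/
theorem abs_rescaled_le_of_clustering (r : LatticeRep G) {M : ℕ} (hM : 2 ≤ M) {β κ C : ℝ}
    (hκ : 0 < κ) {S₁ : ℕ}
    (hC : ∀ S n : ℕ, S₁ ≤ S → n ≤ S →
      |latticeConnectedCorr r.ρ β (2 * S + 1) r.curvature.F r.curvature.F n| ≤
        C * Real.exp (-(κ * n)))
    {L₁ : ℕ} (hL₁ : 1 ≤ L₁) {ε : ℝ} (hε : 0 < ε) :
    ∃ m₁ : ℕ, ∀ (m L : ℕ), m₁ ≤ m → L₁ * M ^ m ≤ L →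
      |((M : ℝ) ^ m) ^ 8 *
          latticeConnectedCorr r.ρ β (2 * L + 1) r.curvature.F r.curvature.F (M ^ m)| ≤ ε := by
  -- the tail bound is eventually `≤ ε`, and the separation `M^m` eventually exceeds `S₁`
  have h1 : ∀ᶠ m : ℕ in atTop,
      ((M : ℝ) ^ m) ^ 8 * (C * Real.exp (-(κ * (M : ℝ) ^ m))) ≤ ε :=
    (tendsto_rescaled_expTail hM hκ C).eventually (ge_mem_nhds hε)
  have h2 : ∀ᶠ m : ℕ in atTop, S₁ ≤ M ^ m :=
    (tendsto_pow_atTop_atTop_of_one_lt (lt_of_lt_of_le one_lt_two hM)).eventually_ge_atTop S₁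
  obtain ⟨m₁, hm₁⟩ := (h1.and h2).exists_forall_of_atTop
  refine ⟨m₁, fun m L hm hL => ?_⟩
  obtain ⟨hε', hS₁⟩ := hm₁ m hm
  have hDL : M ^ m ≤ L := le_trans (by simpa using Nat.mul_le_mul_right (M ^ m) hL₁) hL
  have hcorr := hC L (M ^ m) (hS₁.trans hDL) hDL
  rw [Nat.cast_pow] at hcorr
  rw [abs_mul, abs_of_nonneg (by positivity : (0 : ℝ) ≤ ((M : ℝ) ^ m) ^ 8)]
  exact (mul_le_mul_of_nonneg_left hcorr (by positivity)).trans hε'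

/-- **Eventual smallness at every precision ⇒ the slack inequality, for EVERY factor `K > 0`.**  If at
the coupling `β` and aspect `L₁`, for every `δ > 0`, `|u(β, m, L)| ≤ δ` for all `m` beyond a threshold
and all `L ≥ L₁ M^m`, then for `K > 0`, `ε > 0` there is `m₁` with
`u(β, m, L₁ M^m) ≤ K · u(β, m, L) + ε` for all `m ≥ m₁`, `L ≥ L₁ M^m`: run the hypothesis at
`δ := min (ε/2) (ε/(2K))` and close with `FixedAspectSplit.slack_of_abs_le`. [folklore] -/
theorem volumeSlack_of_abs_eventually (r : LatticeRep G) {M : ℕ} {β : ℝ} {L₁ : ℕ}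
    (h : ∀ δ : ℝ, 0 < δ → ∃ m₁ : ℕ, ∀ (m L : ℕ), m₁ ≤ m → L₁ * M ^ m ≤ L →
      |((M : ℝ) ^ m) ^ 8 *
          latticeConnectedCorr r.ρ β (2 * L + 1) r.curvature.F r.curvature.F (M ^ m)| ≤ δ)
    {K : ℝ} (hK : 0 < K) {ε : ℝ} (hε : 0 < ε) :
    ∃ m₁ : ℕ, ∀ (m L : ℕ), m₁ ≤ m → L₁ * M ^ m ≤ L →
      ((M : ℝ) ^ m) ^ 8 *
          latticeConnectedCorr r.ρ β (2 * (L₁ * M ^ m) + 1) r.curvature.F r.curvature.F (M ^ m) ≤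
        K * (((M : ℝ) ^ m) ^ 8 *
          latticeConnectedCorr r.ρ β (2 * L + 1) r.curvature.F r.curvature.F (M ^ m)) + ε := by
  obtain ⟨m₁, hm₁⟩ := h (min (ε / 2) (ε / (2 * K))) (lt_min (by positivity) (by positivity))
  refine ⟨m₁, fun m L hm hL => FixedAspectSplit.slack_of_abs_le hK ?_ ?_⟩
  · exact (hm₁ m (L₁ * M ^ m) hm le_rfl).trans (min_le_left _ _)
  · exact (hm₁ m L hm hL).trans (min_le_right _ _)

end FixedData

/-! ## §3 Under the crux prefix, from the sibling items `FemtoCurvatureTwoPointC` + `LatticeGapInUVUnitsC` -/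

open Summit.QuantumFields.YangMills.Theses.LangevinControlUV (FemtoCurvatureTwoPointC
  LatticeGapInUVUnitsC)

/-- **Companion: `|u(β, m, L)| ≤ ε` in the fixed-coupling infrared tail, modulo the sibling legs.**
From `FemtoCurvatureTwoPointC` (a continuous unit map `a`, `a(β) > 0`, carrying the femto package) and
`LatticeGapInUVUnitsC` (clustering of `(P, P)` at rate `c₁ a(β)` beyond `S₁(β)` for `β ≥ β₂`, with a
`β`-uniform constant): for every `(G, r)` there is `β₂ = β₂(G, r)` such that for every `M ≥ 2`, at
each FIXED `β ≥ β₂`, for all `L₁ ≥ 1`, `ε > 0`, there is a depth threshold `m₁ = m₁(β, M, L₁, ε)` with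
`|(M^m)⁸ ⟨P ; τ_{M^m} P⟩_{β, 2L+1}| ≤ ε` for all `m ≥ m₁`, `L ≥ L₁ M^m`. [folklore] -/
theorem abs_rescaled_le_of_gapC (hF : FemtoCurvatureTwoPointC) (hGap : LatticeGapInUVUnitsC) :
    ∀ (G : Type) [Group G] [TopologicalSpace G] [IsTopologicalGroup G] [CompactSpace G],
      IsCompactSimpleLieGroup G → letI : MeasurableSpace G := borel G
      haveI : BorelSpace G := ⟨rfl⟩
      ∀ (r : LatticeRep G), ∃ β₂ : ℝ, ∀ (M : ℕ), 2 ≤ M → ∀ β : ℝ, β₂ ≤ β → ∀ L₁ : ℕ, 1 ≤ L₁ →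
        ∀ ε : ℝ, 0 < ε → ∃ m₁ : ℕ, ∀ (m L : ℕ), m₁ ≤ m → L₁ * M ^ m ≤ L →
          |((M : ℝ) ^ m) ^ 8 *
              latticeConnectedCorr r.ρ β (2 * L + 1) r.curvature.F r.curvature.F (M ^ m)| ≤ ε := by
  intro G _ _ _ _ hG
  letI : MeasurableSpace G := borel G
  haveI : BorelSpace G := ⟨rfl⟩
  intro r
  obtain ⟨a, ha, hP⟩ := hF G hG r
  obtain ⟨c₁, β₂, S₁, hc₁, hAB⟩ := hGap G hG r a ha hP
  obtain ⟨Γ, β₀, ℓ₀, c, C, -, -, hapos, -⟩ := hP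
  obtain ⟨C', hC'⟩ := hAB r.curvature r.curvature
  refine ⟨β₂, fun M hM β hβ L₁ hL₁ ε hε => ?_⟩
  exact abs_rescaled_le_of_clustering r hM (mul_pos hc₁ (hapos β))
    (fun S n hS hn => hC' β hβ S n hS hn) hL₁ hε

/-- **The fixed-coupling infrared tail of (V_slack), uniform threshold form**: modulo the sibling legs,
for every `(G, r)` there is `β₂ = β₂(G, r)` such that for every `M ≥ 2`, factor `K > 0`, aspect
`L₁ ≥ 1`, slack `ε > 0` and each FIXED `β ≥ β₂` there is a depth threshold `m₁` with
`u(β, m, L₁ M^m) ≤ K · u(β, m, L) + ε` for all `m ≥ m₁` and ALL `L ≥ L₁ M^m`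
(`abs_rescaled_le_of_gapC` + `volumeSlack_of_abs_eventually`). [folklore] -/
theorem volumeSlack_fixedCoupling_of_gapC_uniform (hF : FemtoCurvatureTwoPointC)
    (hGap : LatticeGapInUVUnitsC) :
    ∀ (G : Type) [Group G] [TopologicalSpace G] [IsTopologicalGroup G] [CompactSpace G],
      IsCompactSimpleLieGroup G → letI : MeasurableSpace G := borel G
      haveI : BorelSpace G := ⟨rfl⟩
      ∀ (r : LatticeRep G), ∃ β₂ : ℝ, ∀ (M : ℕ), 2 ≤ M → ∀ (K : ℝ), 0 < K → ∀ (L₁ : ℕ), 1 ≤ L₁ →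
        ∀ (ε : ℝ), 0 < ε → ∀ β : ℝ, β₂ ≤ β → ∃ m₁ : ℕ, ∀ (m L : ℕ), m₁ ≤ m → L₁ * M ^ m ≤ L →
          ((M : ℝ) ^ m) ^ 8 *
              latticeConnectedCorr r.ρ β (2 * (L₁ * M ^ m) + 1) r.curvature.F r.curvature.F (M ^ m) ≤
            K * (((M : ℝ) ^ m) ^ 8 *
              latticeConnectedCorr r.ρ β (2 * L + 1) r.curvature.F r.curvature.F (M ^ m)) + ε := by
  intro G _ _ _ _ hG
  letI : MeasurableSpace G := borel G
  haveI : BorelSpace G := ⟨rfl⟩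
  intro r
  obtain ⟨β₂, h⟩ := abs_rescaled_le_of_gapC hF hGap G hG r
  refine ⟨β₂, fun M hM K hK L₁ hL₁ ε hε β hβ => ?_⟩
  exact volumeSlack_of_abs_eventually r (fun δ hδ => h M hM β hβ L₁ hL₁ δ hδ) hK hε

/-- **BY-PRODUCT of stub `stub_volumeSlack` (registered sub-goal): the fixed-coupling infrared tail of
(V_slack) is free modulo the sibling legs `FemtoCurvatureTwoPointC` (stmt-QuantumFields-16204) and
`LatticeGapInUVUnitsC` (stmt-QuantumFields-16206).**  For every compact simple `G`, faithful unitary `r`,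
`M ≥ 2`, EVERY factor `K > 0`, every aspect `L₁ ≥ 1` and slack `ε > 0` there is `β₂` such that at each
FIXED `β ≥ β₂` there is a depth threshold `m₁ = m₁(β)` with `u(β, m, L₁ M^m) ≤ K · u(β, m, L) + ε` for
all `m ≥ m₁` and ALL `L ≥ L₁ M^m`.  Quantifier order `∃ β₂ ∀ β ∃ m₁(β)` — NOT the stub's
`∃ β₁ m₁ ∀ β ∀ m`: modulo the sibling legs the content of (V_slack) is the uniformity in `β` of this
threshold (specialisation of `volumeSlack_fixedCoupling_of_gapC_uniform`). [folklore] -/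
theorem volumeSlack_fixedCoupling_of_gapC (hF : Summit.QuantumFields.YangMills.Theses.LangevinControlUV.FemtoCurvatureTwoPointC) (hGap : Summit.QuantumFields.YangMills.Theses.LangevinControlUV.LatticeGapInUVUnitsC) : ∀ (G : Type) [Group G] [TopologicalSpace G] [IsTopologicalGroup G] [CompactSpace G], IsCompactSimpleLieGroup G → letI : MeasurableSpace G := borel G; haveI : BorelSpace G := ⟨rfl⟩; ∀ (r : LatticeRep G) (M : ℕ), 2 ≤ M → ∀ (K : ℝ), 0 < K → ∀ (L₁ : ℕ), 1 ≤ L₁ → ∀ (ε : ℝ), 0 < ε → ∃ β₂ : ℝ, ∀ β : ℝ, β₂ ≤ β → ∃ m₁ : ℕ, ∀ (m L : ℕ), m₁ ≤ m → L₁ * M ^ m ≤ L → ((M : ℝ) ^ m) ^ 8 * latticeConnectedCorr r.ρ β (2 * (L₁ * M ^ m) + 1) r.curvature.F r.curvature.F (M ^ m) ≤ K * (((M : ℝ) ^ m) ^ 8 * latticeConnectedCorr r.ρ β (2 * L + 1) r.curvature.F r.curvature.F (M ^ m)) + ε := by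
  intro G _ _ _ _ hG
  letI : MeasurableSpace G := borel G
  haveI : BorelSpace G := ⟨rfl⟩
  intro r M hM K hK L₁ hL₁ ε hε
  obtain ⟨β₂, h⟩ := volumeSlack_fixedCoupling_of_gapC_uniform hF hGap G hG r
  exact ⟨β₂, fun β hβ => h M hM K hK L₁ hL₁ ε hε β hβ⟩

end Summit.QuantumFields.YangMills.Theorems.TunedSequenceExists.SlackInfrared

end
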